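import Summits.BirchSwinnertonDyer.BirchSwinnertonDyer.Theorems.AlignedTransportAtTwoMainConjectureOfRankZeroBSDAtTwoCyclotomicLayerLFunction
import HarnessLib

/-!
# Route `AlignedTransportAtTwo`, crux C2 `MainConjectureOfRankZeroBSDAtTwo` (stmt-BirchSwinnertonDyer-22298):
# THE WEIGHT OF THE LAYER PRIMES — `Φ_{p^{n+1}}(1+T)` has weight ONE (`‖Φ(1)‖ = p⁻¹`), so a layer prime can only be matched by a
# prime factor of the SAME degree `pⁿ(p−1)` AND weight one; all layer primes dividing `G` weigh `‖G(0)‖ ≤ p^{−#layers}`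

HONEST FRAMING (cell `bsd-f1-sign2`, WIDTH-5 attached prover seat `bsd-line-att-p5` gen 37 on line `birth` of the lead `bsd-line-att-p2`;
`--supports` stmt-BirchSwinnertonDyer-22298, closes nothing; BSD is NOT proved by any of this; the crux C2, its verdict «blocked-on
`Rank1Residual.GreenbergMuConjectureIrreducible`» and every registered stub are untouched). PURE COMMUTATIVE ALGEBRA over `Λ = ℤ_p⟦T⟧` —
THEOREMS ONLY (no `def`, no named fact, no `sorry`). Sequel of the lineage's `…CyclotomicLayerPrime` / `…CyclotomicLayerRankBudget` (g36):
there the layer polynomials `Ψ_n = Φ_{p^{n+1}}(1+T)` (spelled `(((cyclotomic (p ^ (n+1)) ℤ_[p]).comp (X + 1) : ℤ_[p][X]) : Λ)`, no new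
definition) were shown PRIME of `λ = pⁿ(p−1)` with `‖Ψ_n(0)‖ = p⁻¹`, pairwise non-associated, and `∑_{growth layers} pⁿ(p−1) ≤ λ` (the DEGREE budget).
This file is the WEIGHT bookkeeping (weight of `P` := `ord_p P(0)`, read through `‖P(0)‖`):

* §1 `lam_le_lam_of_dvd`, `norm_constantCoeff_le_of_dvd` (a divisor has smaller `λ` and larger constant-term norm);
  `not_cyclotomicLayer_dvd_of_lam_lt`, `not_cyclotomicLayer_dvd_pow_of_lam_lt` (a non-zero `Q` with `λ(Q) < pⁿ(p−1)` has `Ψ_n ∤ Q^k`).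
* §2 ★ `associated_of_cyclotomicLayer_dvd_of_irreducible` — **`Ψ_n ∣ H`, `H` irreducible ⇒ `Ψ_n ~ H`**, hence (`lam_mu_norm_of_cyclotomicLayer_dvd_of_irreducible`)
  **`λ(H) = pⁿ(p−1)`, `μ(H) = 0`, `‖H(0)‖ = p⁻¹`**: an irreducible element of weight `≠ 1` (`‖H(0)‖ ≠ p⁻¹`) or of degree `≠ pⁿ(p−1)` is NEVER divisible
  by the layer prime (`not_cyclotomicLayer_dvd_of_irreducible_of_norm_ne`, `…_of_lam_ne`); multiset form `exists_mem_associated_of_cyclotomicLayer_dvd_prod`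
  (**`Ψ_n ∣ C(p^m)·∏ S`, `S` primes ⇒ some `P ∈ S` has `P ~ Ψ_n`, `λ(P) = pⁿ(p−1)`, `‖P(0)‖ = p⁻¹`**) — the MATCHING LAW used on `L_p` in the companion file.
* §3 ★ `norm_constantCoeff_le_of_forall_cyclotomicLayer_dvd` — **THE WEIGHT BUDGET: `(∀ n ∈ S, Ψ_n ∣ G) ⇒ ‖G(0)‖ ≤ p^{−#S}`**; `card_le_of_forall_cyclotomicLayer_dvd`
  (**`‖G(0)‖ = p^{−w} ⇒ #S ≤ w`**): at most `ord_p G(0)` layer primes divide `G`, however large `λ(G)` is.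
* §4 (`p = 2`) `not_cyclotomicLayer_dvd_X_add_C_two_pow` (`n ≥ 1 ⇒ Ψ_n ∤ (T+2)^k`: `T + 2 = Ψ_0`), `cyclotomicLayer_dvd_of_dvd_X_add_C_two_pow_mul`
  (`Ψ_n ∣ (T+2)^k·M ⇒ Ψ_n ∣ M`) — the road's cofactor receives every layer prime above `ℚ(√2)`.

References: L. Washington, GTM 83, Prop. 7.2, Thm. 7.3, §13.2 (`Λ` is a UFD whose primes are `p` and the irreducible distinguished polynomials)
[Washington1997]; R. Greenberg, LNM 1716 (1999), §5 pp. 132 and 176–177 [GreenbergLNM1716]; S. Lang, Cyclotomic Fields I–II, Ch. 5 §1–§2 [Lang1990].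
-/

set_option linter.dupNamespace false
set_option autoImplicit false

noncomputable section

open scoped Classical Polynomial

namespace Summit.BirchSwinnertonDyer.BirchSwinnertonDyer.Theorems.AlignedTransportAtTwoCyclotomicLayerWeight

open Polynomial Literature.NumberTheory.EllipticCurves
  Summit.BirchSwinnertonDyer.Rank1Residual.X1.MuLambda
  Summit.BirchSwinnertonDyer.Rank1Residual.X1.ParitySqueeze
  Summit.BirchSwinnertonDyer.Rank1Residual.Iwasawa
  Summit.BirchSwinnertonDyer.BirchSwinnertonDyer.Theorems.AlignedTransportAtTwoTwoFixedPoints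
  Summit.BirchSwinnertonDyer.BirchSwinnertonDyer.Theorems.AlignedTransportAtTwoEisensteinRigidity
  Summit.BirchSwinnertonDyer.BirchSwinnertonDyer.Theorems.AlignedTransportAtTwoEisensteinRigidityPrime
  Summit.BirchSwinnertonDyer.BirchSwinnertonDyer.Theorems.AlignedTransportAtTwoCyclotomicLayerPrime
  Summit.BirchSwinnertonDyer.BirchSwinnertonDyer.Theorems.AlignedTransportAtTwoCyclotomicLayerRankBudget
  Summit.BirchSwinnertonDyer.BirchSwinnertonDyer.Theorems.AlignedTransportAtTwoCyclotomicLayerLFunction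
  Summit.BirchSwinnertonDyer.BirchSwinnertonDyer.Theorems.DefectPrime

variable {p : ℕ} [hp : Fact p.Prime]

/-! ## §1 Divisors: smaller `λ`, larger constant-term norm; small `λ` excludes the layer primes -/

/-- A divisor of a non-zero `G ∈ Λ` has `λ ≤ λ(G)` (`λ` is additive). [cite: Washington1997, §7.1] -/
theorem lam_le_lam_of_dvd {F G : PowerSeries ℤ_[p]} (hG : G ≠ 0) (h : F ∣ G) : lam F ≤ lam G := by
  obtain ⟨q, rfl⟩ := h
  have hF : F ≠ 0 := left_ne_zero_of_mul hG
  have hq : q ≠ 0 := right_ne_zero_of_mul hG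
  rw [lam_mul hF hq]
  exact Nat.le_add_right _ _

/-- A divisor of `G ∈ Λ` has `‖G(0)‖ ≤ ‖F(0)‖` (the cofactor's constant term has norm `≤ 1`). [folklore] -/
theorem norm_constantCoeff_le_of_dvd {F G : PowerSeries ℤ_[p]} (h : F ∣ G) : ‖PowerSeries.constantCoeff G‖ ≤ ‖PowerSeries.constantCoeff F‖ := by
  obtain ⟨q, rfl⟩ := h
  rw [map_mul, norm_mul]
  exact mul_le_of_le_one_right (norm_nonneg _) (PadicInt.norm_le_one _)

/-- **`Q ≠ 0`, `λ(Q) < pⁿ(p−1) ⇒ Ψ_n ∤ Q`** (`λ(Ψ_n) = pⁿ(p−1)` would be at most `λ(Q)`). [cite: Washington1997, Thm. 7.3] -/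
theorem not_cyclotomicLayer_dvd_of_lam_lt {Q : PowerSeries ℤ_[p]} (hQ : Q ≠ 0) {n : ℕ} (hlt : lam Q < p ^ n * (p - 1)) :
    ¬ (((cyclotomic (p ^ (n + 1)) ℤ_[p]).comp (X + 1) : ℤ_[p][X]) : PowerSeries ℤ_[p]) ∣ Q := by
  intro h
  have hle := lam_le_lam_of_dvd hQ h
  rw [lam_cyclotomicLayer] at hle
  omega

/-- **`Q ≠ 0`, `λ(Q) < pⁿ(p−1) ⇒ Ψ_n ∤ Q^k`** (`Ψ_n` is prime, so it would divide `Q`). [cite: Washington1997, Thm. 7.3 and §13.2] -/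
theorem not_cyclotomicLayer_dvd_pow_of_lam_lt {Q : PowerSeries ℤ_[p]} (hQ : Q ≠ 0) {n : ℕ} (hlt : lam Q < p ^ n * (p - 1)) (k : ℕ) :
    ¬ (((cyclotomic (p ^ (n + 1)) ℤ_[p]).comp (X + 1) : ℤ_[p][X]) : PowerSeries ℤ_[p]) ∣ Q ^ k :=
  fun h ↦ not_cyclotomicLayer_dvd_of_lam_lt hQ hlt ((prime_coe_cyclotomic_comp p n).dvd_of_dvd_pow h)

/-- `Ψ_n ∣ Q^k · M`, `Q ≠ 0`, `λ(Q) < pⁿ(p−1) ⇒ Ψ_n ∣ M`. [cite: Washington1997, §13.2] -/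
theorem cyclotomicLayer_dvd_of_dvd_pow_mul_of_lam_lt {Q M : PowerSeries ℤ_[p]} (hQ : Q ≠ 0) {n : ℕ} (hlt : lam Q < p ^ n * (p - 1)) {k : ℕ}
    (h : (((cyclotomic (p ^ (n + 1)) ℤ_[p]).comp (X + 1) : ℤ_[p][X]) : PowerSeries ℤ_[p]) ∣ Q ^ k * M) :
    (((cyclotomic (p ^ (n + 1)) ℤ_[p]).comp (X + 1) : ℤ_[p][X]) : PowerSeries ℤ_[p]) ∣ M :=
  ((prime_coe_cyclotomic_comp p n).dvd_or_dvd h).resolve_left (not_cyclotomicLayer_dvd_pow_of_lam_lt hQ hlt k)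

/-! ## §2 A layer prime dividing an irreducible element IS that element: same degree, weight one -/

/-- ★ **`Ψ_n ∣ H`, `H` irreducible ⇒ `Ψ_n ~ H`** (`H = Ψ_n·u` and `Ψ_n` is not a unit, so `u` is). [cite: Washington1997, §13.2] -/
theorem associated_of_cyclotomicLayer_dvd_of_irreducible {H : PowerSeries ℤ_[p]} (hH : Irreducible H) {n : ℕ}
    (h : (((cyclotomic (p ^ (n + 1)) ℤ_[p]).comp (X + 1) : ℤ_[p][X]) : PowerSeries ℤ_[p]) ∣ H) :
    Associated ((((cyclotomic (p ^ (n + 1)) ℤ_[p]).comp (X + 1) : ℤ_[p][X]) : PowerSeries ℤ_[p])) H := by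
  obtain ⟨u, hu⟩ := h
  rcases hH.isUnit_or_isUnit hu with h1 | h2
  · exact absurd h1 (prime_coe_cyclotomic_comp p n).not_unit
  · exact ⟨h2.unit, by rw [IsUnit.unit_spec]; exact hu.symm⟩

/-- **An associate of `Ψ_n` has `λ = pⁿ(p−1)`, `μ = 0` and weight one `‖P(0)‖ = p⁻¹`.** [cite: Washington1997, Thm. 7.3] -/
theorem lam_mu_norm_of_associated_cyclotomicLayer {P : PowerSeries ℤ_[p]} {n : ℕ}
    (h : Associated ((((cyclotomic (p ^ (n + 1)) ℤ_[p]).comp (X + 1) : ℤ_[p][X]) : PowerSeries ℤ_[p])) P) :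
    lam P = p ^ n * (p - 1) ∧ mu P = 0 ∧ ‖PowerSeries.constantCoeff P‖ = (p : ℝ)⁻¹ := by
  have hP : P ≠ 0 := by
    obtain ⟨u, hu⟩ := h
    rw [← hu]
    exact mul_ne_zero (prime_coe_cyclotomic_comp p n).ne_zero (Units.ne_zero u)
  obtain ⟨hl, hm, hn⟩ := lam_mu_norm_of_associated h hP
  refine ⟨?_, ?_, ?_⟩
  · rw [← hl, lam_cyclotomicLayer]
  · rw [← hm]; exact (mu_coe_cyclotomic_comp p n).1
  · rw [← hn, norm_constantCoeff_cyclotomicLayer]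

/-- ★ **`Ψ_n ∣ H`, `H` irreducible ⇒ `λ(H) = pⁿ(p−1)`, `μ(H) = 0`, `‖H(0)‖ = p⁻¹`.** A prime cofactor of the `p`-adic `L`-function can host the layer-`(n+1)`
zeros only if it has EXACTLY the degree `φ(p^{n+1})` and weight ONE. [cite: Washington1997, Thm. 7.3 and §13.2] [cite: GreenbergLNM1716, §5 p. 177] -/
theorem lam_mu_norm_of_cyclotomicLayer_dvd_of_irreducible {H : PowerSeries ℤ_[p]} (hH : Irreducible H) {n : ℕ}
    (h : (((cyclotomic (p ^ (n + 1)) ℤ_[p]).comp (X + 1) : ℤ_[p][X]) : PowerSeries ℤ_[p]) ∣ H) :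
    lam H = p ^ n * (p - 1) ∧ mu H = 0 ∧ ‖PowerSeries.constantCoeff H‖ = (p : ℝ)⁻¹ :=
  lam_mu_norm_of_associated_cyclotomicLayer (associated_of_cyclotomicLayer_dvd_of_irreducible hH h)

/-- **An irreducible `H` of weight `≠ 1` (`‖H(0)‖ ≠ p⁻¹`) is divisible by NO layer prime.** [cite: Washington1997, §13.2] -/
theorem not_cyclotomicLayer_dvd_of_irreducible_of_norm_ne {H : PowerSeries ℤ_[p]} (hH : Irreducible H)
    (hw : ‖PowerSeries.constantCoeff H‖ ≠ (p : ℝ)⁻¹) (n : ℕ) :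
    ¬ (((cyclotomic (p ^ (n + 1)) ℤ_[p]).comp (X + 1) : ℤ_[p][X]) : PowerSeries ℤ_[p]) ∣ H :=
  fun h ↦ hw (lam_mu_norm_of_cyclotomicLayer_dvd_of_irreducible hH h).2.2

/-- **An irreducible `H` with `λ(H) ≠ pⁿ(p−1)` is not divisible by `Ψ_n`.** [cite: Washington1997, Thm. 7.3] -/
theorem not_cyclotomicLayer_dvd_of_irreducible_of_lam_ne {H : PowerSeries ℤ_[p]} (hH : Irreducible H) {n : ℕ}
    (hl : lam H ≠ p ^ n * (p - 1)) :
    ¬ (((cyclotomic (p ^ (n + 1)) ℤ_[p]).comp (X + 1) : ℤ_[p][X]) : PowerSeries ℤ_[p]) ∣ H :=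
  fun h ↦ hl (lam_mu_norm_of_cyclotomicLayer_dvd_of_irreducible hH h).1

/-- **`Ψ_n² ∤ H` for `H` irreducible** (`H = Ψ·(Ψ·u)` would make `Ψ·u`, hence `Ψ`, a unit). [cite: Washington1997, §13.2] -/
theorem not_cyclotomicLayer_sq_dvd_of_irreducible {H : PowerSeries ℤ_[p]} (hH : Irreducible H) (n : ℕ) :
    ¬ (((cyclotomic (p ^ (n + 1)) ℤ_[p]).comp (X + 1) : ℤ_[p][X]) : PowerSeries ℤ_[p]) ^ 2 ∣ H := by
  rintro ⟨u, hu⟩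
  have hΨ := prime_coe_cyclotomic_comp p n
  rw [pow_two, mul_assoc] at hu
  rcases hH.isUnit_or_isUnit hu with hU | hU
  · exact hΨ.not_unit hU
  · exact hΨ.not_unit (isUnit_of_mul_isUnit_left hU)

/-- ★ **THE MATCHING LAW (multiset form).** `Ψ_n ∣ ∏ S` with every member of `S` prime ⇒ **some `P ∈ S` is `~ Ψ_n`**, so `λ(P) = pⁿ(p−1)`,
`μ(P) = 0` and `‖P(0)‖ = p⁻¹`. [cite: Washington1997, §13.2] -/
theorem exists_mem_associated_of_cyclotomicLayer_dvd_prod (S : Multiset (PowerSeries ℤ_[p])) (hS : ∀ P ∈ S, Prime P) {n : ℕ}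
    (h : (((cyclotomic (p ^ (n + 1)) ℤ_[p]).comp (X + 1) : ℤ_[p][X]) : PowerSeries ℤ_[p]) ∣ S.prod) :
    ∃ P ∈ S, Associated ((((cyclotomic (p ^ (n + 1)) ℤ_[p]).comp (X + 1) : ℤ_[p][X]) : PowerSeries ℤ_[p])) P ∧
      lam P = p ^ n * (p - 1) ∧ mu P = 0 ∧ ‖PowerSeries.constantCoeff P‖ = (p : ℝ)⁻¹ := by
  obtain ⟨P, hP, hdvd⟩ := (prime_coe_cyclotomic_comp p n).exists_mem_multiset_dvd h
  have hass := associated_of_cyclotomicLayer_dvd_of_irreducible (hS P hP).irreducible hdvd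
  exact ⟨P, hP, hass, lam_mu_norm_of_associated_cyclotomicLayer hass⟩

/-- **The matching law behind a `p`-power**: `Ψ_n ∣ C(p^m)·∏ S`, members of `S` prime ⇒ some `P ∈ S` is `~ Ψ_n` (`Ψ_n ∤ p^m`, `λ(p^m) = 0`).
This is Kato's shape `f_X · a = p^m · L₀` with a certified prime factorisation of `L₀`. [cite: Washington1997, §13.2] [cite: Kato2004Asterisque, Thm. 17.4 (2) (p. 273)] -/
theorem exists_mem_associated_of_cyclotomicLayer_dvd_C_pow_mul_prod (S : Multiset (PowerSeries ℤ_[p])) (hS : ∀ P ∈ S, Prime P) {n m : ℕ}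
    (h : (((cyclotomic (p ^ (n + 1)) ℤ_[p]).comp (X + 1) : ℤ_[p][X]) : PowerSeries ℤ_[p]) ∣ PowerSeries.C ((p : ℤ_[p]) ^ m) * S.prod) :
    ∃ P ∈ S, Associated ((((cyclotomic (p ^ (n + 1)) ℤ_[p]).comp (X + 1) : ℤ_[p][X]) : PowerSeries ℤ_[p])) P ∧
      lam P = p ^ n * (p - 1) ∧ mu P = 0 ∧ ‖PowerSeries.constantCoeff P‖ = (p : ℝ)⁻¹ :=
  exists_mem_associated_of_cyclotomicLayer_dvd_prod S hS
    (((prime_coe_cyclotomic_comp p n).dvd_or_dvd h).resolve_left (not_cyclotomicLayer_dvd_C_pow n m))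

/-! ## §3 The weight budget: the layer primes dividing `G` weigh `‖G(0)‖ ≤ p^{−#layers}` -/

/-- `‖(∏_{n∈S} Ψ_n)(0)‖ = p^{−#S}` (each layer prime has weight one). [folklore] -/
theorem norm_constantCoeff_prod_cyclotomicLayer (S : Finset ℕ) :
    ‖PowerSeries.constantCoeff (∏ n ∈ S, (((cyclotomic (p ^ (n + 1)) ℤ_[p]).comp (X + 1) : ℤ_[p][X]) : PowerSeries ℤ_[p]))‖ =
      (p : ℝ)⁻¹ ^ S.card := by
  induction S using Finset.induction_on with
  | empty => simp
  | insert a S haS ih =>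
    rw [Finset.prod_insert haS, map_mul, norm_mul, ih, norm_constantCoeff_cyclotomicLayer, Finset.card_insert_of_notMem haS, pow_succ,
      mul_comm]

/-- ★ **THE WEIGHT BUDGET: `(∀ n ∈ S, Ψ_n ∣ G) ⇒ ‖G(0)‖ ≤ p^{−#S}`** — all the layer primes dividing `G` divide it simultaneously
(`prod_cyclotomicLayer_dvd_of_forall_dvd`, g36) and each weighs one power of `p` at `T = 0`. Independent of the degree budget `∑ pⁿ(p−1) ≤ λ(G)`.
[cite: Washington1997, §7.1 and §13.2] [cite: GreenbergLNM1716, Thm. 1.9 (p. 63)] -/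
theorem norm_constantCoeff_le_of_forall_cyclotomicLayer_dvd (S : Finset ℕ) {G : PowerSeries ℤ_[p]}
    (h : ∀ n ∈ S, (((cyclotomic (p ^ (n + 1)) ℤ_[p]).comp (X + 1) : ℤ_[p][X]) : PowerSeries ℤ_[p]) ∣ G) :
    ‖PowerSeries.constantCoeff G‖ ≤ (p : ℝ)⁻¹ ^ S.card := by
  have hle := norm_constantCoeff_le_of_dvd (prod_cyclotomicLayer_dvd_of_forall_dvd S h)
  rwa [norm_constantCoeff_prod_cyclotomicLayer] at hle

/-- ★ **`‖G(0)‖ = p^{−w}` and `Ψ_n ∣ G` for every `n ∈ S` ⇒ `#S ≤ w`**: at most `ord_p G(0)` layer primes divide `G`. [cite: Washington1997, §7.1 and §13.2] -/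
theorem card_le_of_forall_cyclotomicLayer_dvd (S : Finset ℕ) {G : PowerSeries ℤ_[p]} {w : ℕ} (hw : ‖PowerSeries.constantCoeff G‖ = (p : ℝ)⁻¹ ^ w)
    (h : ∀ n ∈ S, (((cyclotomic (p ^ (n + 1)) ℤ_[p]).comp (X + 1) : ℤ_[p][X]) : PowerSeries ℤ_[p]) ∣ G) : S.card ≤ w := by
  have hle := norm_constantCoeff_le_of_forall_cyclotomicLayer_dvd S h
  rw [hw] at hle
  have hp1 : (1 : ℝ) < p := by exact_mod_cast hp.out.one_lt
  have h0 : (0 : ℝ) < (p : ℝ)⁻¹ := inv_pos.mpr (by linarith)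
  have h1 : (p : ℝ)⁻¹ < 1 := inv_lt_one_of_one_lt₀ hp1
  exact (pow_le_pow_iff_right_of_lt_one₀ h0 h1).mp hle

/-- **No layer prime divides a `G` of weight zero** (`‖G(0)‖ = 1`, i.e. `G ∈ Λˣ`). [folklore] -/
theorem not_cyclotomicLayer_dvd_of_norm_constantCoeff_eq_one {G : PowerSeries ℤ_[p]} (hw : ‖PowerSeries.constantCoeff G‖ = 1) (n : ℕ) :
    ¬ (((cyclotomic (p ^ (n + 1)) ℤ_[p]).comp (X + 1) : ℤ_[p][X]) : PowerSeries ℤ_[p]) ∣ G := by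
  intro h
  have h1 := card_le_of_forall_cyclotomicLayer_dvd {n} (w := 0) (by rw [pow_zero]; exact hw) (by simpa using h)
  simp at h1

/-! ## §4 `p = 2`: above `ℚ(√2)` every layer prime lands in the cofactor of `(T+2)^k` -/

/-- **`n ≥ 1 ⇒ Ψ_n ∤ (T+2)^k`** in `ℤ₂⟦T⟧` (`λ(T+2) = 1 < 2ⁿ`; `T + 2 = Φ₂(1+T) = Ψ_0` is the layer-one prime). [cite: Washington1997, §13.2] -/
theorem not_cyclotomicLayer_dvd_X_add_C_two_pow {n : ℕ} (hn : 1 ≤ n) (k : ℕ) :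
    ¬ (((cyclotomic (2 ^ (n + 1)) ℤ_[2]).comp (X + 1) : ℤ_[2][X]) : PowerSeries ℤ_[2]) ∣ (PowerSeries.X + PowerSeries.C (2 : ℤ_[2])) ^ k := by
  refine not_cyclotomicLayer_dvd_pow_of_lam_lt prime_X_add_C_two.ne_zero ?_ k
  rw [lam_X_add_C_two]
  have : 2 ≤ 2 ^ n * (2 - 1) := by simpa using Nat.pow_le_pow_right two_pos hn
  omega

/-- **`n ≥ 1`, `Ψ_n ∣ (T+2)^k · M ⇒ Ψ_n ∣ M`**: on the road, every layer prime above the first layer divides the cofactor of the forced `χ₈`-zero.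
[cite: Washington1997, §13.2] [cite: GreenbergLNM1716, §5 p. 177] -/
theorem cyclotomicLayer_dvd_of_dvd_X_add_C_two_pow_mul {n : ℕ} (hn : 1 ≤ n) {k : ℕ} {M : PowerSeries ℤ_[2]}
    (h : (((cyclotomic (2 ^ (n + 1)) ℤ_[2]).comp (X + 1) : ℤ_[2][X]) : PowerSeries ℤ_[2]) ∣ (PowerSeries.X + PowerSeries.C (2 : ℤ_[2])) ^ k * M) :
    (((cyclotomic (2 ^ (n + 1)) ℤ_[2]).comp (X + 1) : ℤ_[2][X]) : PowerSeries ℤ_[2]) ∣ M :=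
  ((prime_coe_cyclotomic_comp 2 n).dvd_or_dvd h).resolve_left (not_cyclotomicLayer_dvd_X_add_C_two_pow hn k)

/-- `λ(Ψ_n) = 2ⁿ` at `p = 2`. [folklore] -/
theorem lam_cyclotomicLayer_two (n : ℕ) :
    lam ((((cyclotomic (2 ^ (n + 1)) ℤ_[2]).comp (X + 1) : ℤ_[2][X]) : PowerSeries ℤ_[2])) = 2 ^ n := by
  rw [lam_cyclotomicLayer]; simp

/-- ★ **`p = 2`, PRIME COFACTOR OF THE WRONG WEIGHT: `G = (T+2)^k · H`, `H` irreducible with `‖H(0)‖₂ ≠ ½` ⇒ `Ψ_n ∤ G` for every `n ≥ 1`** — no layer of the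
`2`-tower above `ℚ(√2)` can put its prime into such a `G` (used on the `λ₂ = 3` row of the `a₂ = −1` road, where `‖H(0)‖₂ = ⅛`).
[cite: Washington1997, §13.2] [cite: GreenbergLNM1716, §5 pp. 176–177] -/
theorem not_cyclotomicLayer_dvd_X_add_C_two_pow_mul_of_irreducible_of_norm_ne {k : ℕ} {H : PowerSeries ℤ_[2]} (hH : Irreducible H)
    (hw : ‖PowerSeries.constantCoeff H‖ ≠ (2 : ℝ)⁻¹) {n : ℕ} (hn : 1 ≤ n) :
    ¬ (((cyclotomic (2 ^ (n + 1)) ℤ_[2]).comp (X + 1) : ℤ_[2][X]) : PowerSeries ℤ_[2]) ∣ (PowerSeries.X + PowerSeries.C (2 : ℤ_[2])) ^ k * H := by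
  intro h
  have hw' : ‖PowerSeries.constantCoeff H‖ ≠ ((2 : ℕ) : ℝ)⁻¹ := by exact_mod_cast hw
  exact not_cyclotomicLayer_dvd_of_irreducible_of_norm_ne hH hw' n (cyclotomicLayer_dvd_of_dvd_X_add_C_two_pow_mul hn h)

/-- ★ **`p = 2`, PRIME COFACTOR OF WEIGHT ONE: `G = (T+2)^k · H`, `H` irreducible, `Ψ_n ∣ G` with `n ≥ 1` ⇒ `H ~ Ψ_n` and `λ(H) = 2ⁿ`**; and `Ψ_n² ∤ G`.
[cite: Washington1997, §13.2] [cite: GreenbergLNM1716, §5 p. 177] -/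
theorem lam_eq_two_pow_of_cyclotomicLayer_dvd_X_add_C_two_pow_mul_of_irreducible {k : ℕ} {H : PowerSeries ℤ_[2]} (hH : Irreducible H)
    {n : ℕ} (hn : 1 ≤ n)
    (h : (((cyclotomic (2 ^ (n + 1)) ℤ_[2]).comp (X + 1) : ℤ_[2][X]) : PowerSeries ℤ_[2]) ∣ (PowerSeries.X + PowerSeries.C (2 : ℤ_[2])) ^ k * H) :
    Associated ((((cyclotomic (2 ^ (n + 1)) ℤ_[2]).comp (X + 1) : ℤ_[2][X]) : PowerSeries ℤ_[2])) H ∧ lam H = 2 ^ n ∧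
      ¬ (((cyclotomic (2 ^ (n + 1)) ℤ_[2]).comp (X + 1) : ℤ_[2][X]) : PowerSeries ℤ_[2]) ^ 2 ∣ (PowerSeries.X + PowerSeries.C (2 : ℤ_[2])) ^ k * H := by
  have h1 := cyclotomicLayer_dvd_of_dvd_X_add_C_two_pow_mul hn h
  refine ⟨associated_of_cyclotomicLayer_dvd_of_irreducible hH h1, ?_, ?_⟩
  · rw [(lam_mu_norm_of_cyclotomicLayer_dvd_of_irreducible hH h1).1]; simp
  · intro h2
    exact not_cyclotomicLayer_sq_dvd_of_irreducible hH n
      ((prime_coe_cyclotomic_comp 2 n).pow_dvd_of_dvd_mul_left 2 (not_cyclotomicLayer_dvd_X_add_C_two_pow hn k) h2)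

end Summit.BirchSwinnertonDyer.BirchSwinnertonDyer.Theorems.AlignedTransportAtTwoCyclotomicLayerWeight
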